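import Summits.BirchSwinnertonDyer.Rank1Residual.X12.ClassClosureO10Refined
import Summits.BirchSwinnertonDyer.Rank1Residual.Additive.QuadraticBranchBSDpOfReadings
import Summits.BirchSwinnertonDyer.Rank1Residual.Additive.QuadraticBranchLowerHalfOfReadings
import Summits.BirchSwinnertonDyer.Rank1Residual.Additive.QuadraticBranchMinusLFunctionExistence
import HarnessLib

/-!
# O10-PS class node OF RECORD, re-pointed to the pair consumers FROM READINGS:
# `LowerHalfOnType p I₀*` (and `BSD(W, p)` per pair) ⟸ C-cc-1 on the type ∧ (C1_η) on the good twins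
# ∧ named facts ∧ two print READINGS ∧ ONE displayed analytic datum (a `p`-integral period ratio)
# (cell `bsd-cm`, seat `bsd-cm-inert` g7; TARGET.md R230 = RULING D45 (3), item N16-K; bookkeeping over
# the tree's theorems; nothing asserted, nothing booked)

HONEST FRAMING (cell `bsd-cm`, run/shared/lean/pub/bsd-cm/): FULL BSD for every analytic-rank `≤ 1`
curve is the programme's target of record. This file SUPERSEDES `X12/ClassClosureO10Refined.lean`'s
`X12.O10.…_of_valuation_of_exactControl` as the O10-PS class node of record (D45 (1)): there the node
bound the typed MISSING INPUT (C3_η) `QuadraticBranchOddStrictExactControlOfPlusMCAt W p` and a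
two-part analytic existence binder `hdata`. Since then, on the sibling cell `b2b-bsdres` (x1b, CITED,
not re-derived): (C3_η) is a THEOREM given the named fact `hPT` (Poitou–Tate for finite Selmer
structures) and two READINGS of printed theorems — `hR2 : OddBranchStrictMinusNoFiniteSubmoduleAt W p`
(Kitajima–Otsuki 2018 Main Thm. 1.3, sign `−`; or its verbatim shape `hKO`) and `h74x` (the EXACT
reading of Kobayashi 2003 Thm. 7.4 (ii) at `η`: (C1_η) ⟹ `Char X^{−,str}(W/ℚ_∞) = (X⁻¹L_p⁻(V, η, X))`;
or its verbatim shape `h74X` on the `η`-part object; for the LOWER half only the inclusion `h74l`) —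
pair consumers p401735 `LevelBridge.bsdp_of_plusMC_of_pAdicGrossZagierValuation_of_readings` and
p400144 `LevelBridge.missingLowerBoundAt_of_plusMC_of_pAdicGrossZagierValuation_of_lowerReading`
(readings REF-6′ FAITHFUL on this cell's books; flags carried BY NAME); and on the sibling cell
`bsd-potss` (ctrl, p401120) the Kobayashi-Thm-3.2 half of `hdata` is a THEOREM
(`quadraticBranch_hdata_of_periodRatio`: `hdata` ⟸ a `p`-INTEGRAL rational period ratio `ϖ` alone).
So here `h3` is REPLACED by `hPT` + the readings and `hdata` by the ONE displayed analytic datum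
`hper` ("for every good `a_p = 0` curve `V` at `p` with newform `f`: a rational `ϖ`, `‖ϖ‖_p ≤ 1`, with
`ϖ·Ω_V = Ω⁺_f` resp. `ϖ·|Ω⁻(V)| = Ω⁻_f`" — rationality and `p`-integrality of the newform/Néron period
ratio; Manin-constant territory, item N17). The hypothesis "`W(ℚ_p)[p] = 0`" of the pair consumers is
DISCHARGED by x1b's file 8 (`eq_zero_of_prime_smul_eq_zero_padic_of_quadraticTwist_goodSupersingular`,
S-dup: found, not re-proved). The twin `V`, `C`, the newform, the generator and its level are PRODUCED
inside (`pairData_elim`, the old node's body). STATEMENT OF RECORD after this file (D45 (1)):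
«`LowerHalfOnType p I₀*` (hence `BSD_p` on every O10-PS pair, `p ≥ 5`) ⟸ C-cc-1 on the type ∧ (C1_η)
on the CM good-inert twins ∧ named facts {`hmod`, `hGZ`, `hGZK`, `hPT`, `hnf`} ∧ print readings
{KO18 (R2), Kob03 7.4 (ii)} (for the lower half: Kob03 7.4 (ii) `⊆` ONLY) ∧ ONE displayed analytic
datum `hper`». All conjecture inputs are typed `@[conjecture]`s (C-cc-1
`QuadraticBranchPAdicGrossZagierValuationAt`, OUR conjecture, in no source; (C1_η)
`QuadraticBranchPlusMainConjectureAt`, conjecture in print) — NOT claimed; (C3_η) is no longer an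
input; O10 stays OPEN at class level («O10 (CM, r_an = 1, odd p inert in K, p ∣ N): no CLASS-level
treatment in print», D46 (2)); no label / mark / count moves; nothing booked.

## Contents
§0 `pairData_elim` (the data a pair consumer binds, produced on the type); §1 pair level:
`bsdp_…_of_valuation_of_readings` (`hR2`, `h74x`), `missingLowerBoundAt_…_of_valuation_of_lowerReading`
(`h74l` only), `bsdp_…_of_valuation_of_verbatimReadings` (`hKO`, `h74X`: `W`-free); §2 class level:
`lowerHalfOnType_IstarZero_of_valuation_of_lowerReading` (THE NODE OF RECORD: fewest inputs),
`lowerHalfOnType_IstarZero_of_valuation_of_readings` (the class form of the verbatim variant is the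
3-line `lowerHalfOnType_of_forall_bsdp hGZK (fun W _ _ hT hr ↦ bsdp_…_verbatimReadings … W …)`).

References (locators only): [Kobayashi2003] Thm. 3.2 (p. 7), §4 (p. 8), Thm. 7.4 (p. 13), Thm. 9.3
(p. 26); [KitajimaOtsuki2018] Main Thm. 1.3; [Miller2011LMS] §1, Def. 1.1; [Tian2023CongruentICM]
p. 1993; [SilvermanAEC2009] VII.6.3, VIII.6.7; [SerreInventiones1972] §1.11 Prop. 12.
-/

noncomputable section

open scoped Classical MatrixGroups ModularForm NumberField

open CongruenceSubgroup Field WeierstrassCurve Literature.NumberTheory.EllipticCurves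
  Literature.NumberTheory.EllipticCurves.ModularForms
  Literature.NumberTheory.EllipticCurves.Kobayashi2003
  Literature.NumberTheory.EllipticCurves.Rank1Residual
  Literature.NumberTheory.EllipticCurves.Rank1Residual.Typed
  Literature.NumberTheory.GaloisRepresentations Literature.NumberTheory.GaloisCohomology
  Summit.BirchSwinnertonDyer.Rank1Residual.Additive

-- Over `ℚ` two `ℚ`-algebra structures on a completion are in scope; the general-`K` statements must be
-- met by the completion's own (as in the pair consumers' files).
attribute [local instance 10000] IsDedekindDomain.HeightOneSpectrum.instAlgebraAdicCompletion
  NumberField.Place.instAlgebraCompletion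

namespace Summit.BirchSwinnertonDyer.Rank1Residual.X12.O10

variable {p : ℕ} [hp : Fact p.Prime]

/-! ## §0 The pair data, produced -/

/-- **The data a pair consumer binds, PRODUCED for a rank-one CM curve `W` of signed local type
`(p, I₀*)`, `p ≥ 5`** (eliminator form): the globally minimal CM good-inert twin `V` with
`C • W^{(p*)} = V`, `a_p(V) = 0` (`exists_goodTwist_pStar_of_hasSignedLocalType_IstarZero`); its
newform (`hnf`); the period ratio `ϖ` and a branch function `L` with the interpolation property of
`L_p⁻(V, η, X)` (from the displayed datum `hper` by ctrl's `quadraticBranch_hdata_of_periodRatio`,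
Kobayashi Thm. 3.2); "`W(ℚ_p)[p] = 0`" (x1b's
`eq_zero_of_prime_smul_eq_zero_padic_of_quadraticTwist_goodSupersingular`); a generator `P` of
`W(ℚ)/tors` (GZK `hGZK` + Mordell–Weil) and its `p`-divisibility level `n` in `W(ℚ_p)`. Bookkeeping
over tree theorems; nothing asserted. [cite: Kobayashi2003, Thm. 3.2 (p. 7)]
[cite: SilvermanAEC2009, Prop. VII.6.3 and Thm. VIII.6.7] [cite: SerreInventiones1972, §1.11 Prop. 12] -/
theorem pairData_elim (hGZK : rank_eq_analyticRank_of_analyticRank_le_one) (hnf : exists_isNewformOf)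
    (hper : ∀ (V : WeierstrassCurve ℚ) [V.IsElliptic] [V.IsGloballyMinimal]
      {N : ℕ} [NeZero N] (f : CuspForm (Gamma0 N) 2), IsNewformOf V f →
      V.HasGoodReductionAtPrime p → V.frobeniusTrace p = 0 →
      ∃ ϖ : ℚ, ‖(ϖ : ℚ_[p])‖ ≤ 1 ∧
        (if Even (p / 2) then (ϖ : ℝ) * V.realPeriodRat = plusPeriod f
          else (ϖ : ℝ) * V.imaginaryPeriodRat = minusPeriod f))
    (W : WeierstrassCurve ℚ) [W.IsElliptic] [W.IsGloballyMinimal]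
    (hT : HasSignedLocalType W p (.Istar 0)) (hr : W.analyticRank = 1) (hp5 : 5 ≤ p)
    {motive : Prop}
    (k : ∀ (V : WeierstrassCurve ℚ) [V.IsElliptic] [V.IsGloballyMinimal] (C : VariableChange ℚ)
      {N : ℕ} [NeZero N] (f : CuspForm (Gamma0 N) 2) (ϖ : ℚ) (L : IwasawaAlgebra p)
      (P : W.toAffine.Point) (n : ℕ),
      C • W.quadraticTwist ((-1) ^ (p / 2) * p) = V → V.HasGoodReductionAtPrime p →
      V.frobeniusTrace p = 0 → V.HasCM → CMInert V p → IsNewformOf V f →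
      (if Even (p / 2) then (ϖ : ℝ) * V.realPeriodRat = plusPeriod f
        else (ϖ : ℝ) * V.imaginaryPeriodRat = minusPeriod f) →
      IsQuadraticBranchMinusLFunction f p ϖ L →
      (∀ Q : (W.baseChange ℚ_[p]).toAffine.Point, p • Q = 0 → Q = 0) →
      ¬ IsOfFinAddOrder P →
      (∀ R : W.toAffine.Point, ∃ (k : ℤ) (T : W.toAffine.Point),
        IsOfFinAddOrder T ∧ R = k • P + T) →
      (∃ Q : (W.baseChange ℚ_[p]).toAffine.Point, p ^ n • Q = W.toPadicPoint p P) →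
      (∀ Q : (W.baseChange ℚ_[p]).toAffine.Point, p ^ (n + 1) • Q ≠ W.toPadicPoint p P) →
      motive) :
    motive := by
  have hp2 : p ≠ 2 := by omega
  -- the good supersingular CM twin and the change of variables
  obtain ⟨V, hVe, hVm, C, hC, hgood, hap, hCM, hin, -⟩ :=
    exists_goodTwist_pStar_of_hasSignedLocalType_IstarZero W hT hp5
  -- the newform of the twin (modularity), the period ratio (displayed) and the branch function (ctrl)
  haveI : NeZero (V.conductorNorm ℤ) := ⟨(V.conductorNorm_pos_holds).ne'⟩
  obtain ⟨f, hf⟩ := hnf V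
  obtain ⟨ϖ, hϖ, L, hL⟩ := quadraticBranch_hdata_of_periodRatio hp2 hper V f hf hgood hap
  -- Mordell–Weil: rank one (GZK), a generator modulo torsion, and its `p`-divisibility level
  obtain ⟨hrank, -⟩ := hGZK W hr.le
  have hrank1 : W.mordellWeilRank = 1 := by rw [hrank, hr]
  obtain ⟨P, hP, hgen⟩ := exists_generator_of_mordellWeilRank_eq_one W hrank1
  obtain ⟨lam, hlam⟩ := exists_addMonoidHom_padicInt_apply_eq_zero_iff p (W.baseChange ℚ_[p])
  have hinj : Function.Injective (W.toPadicPoint p) :=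
    Affine.Point.map_injective (W' := W) (Algebra.ofId ℚ ℚ_[p])
  have hP' : ¬ IsOfFinAddOrder P := by convert hP
  have hPp : ¬ IsOfFinAddOrder (W.toPadicPoint p P) := by
    intro h
    apply hP'
    obtain ⟨m, hm, hmP⟩ := isOfFinAddOrder_iff_nsmul_eq_zero.mp h
    refine isOfFinAddOrder_iff_nsmul_eq_zero.mpr ⟨m, hm, hinj ?_⟩
    rw [map_nsmul, map_zero]
    exact hmP
  obtain ⟨n, hdiv, hndiv⟩ := StrictSha.exists_level_of_not_isOfFinAddOrder p lam hlam hPp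
  have hgen' : ∀ R : W.toAffine.Point, ∃ (k : ℤ) (T : W.toAffine.Point),
      IsOfFinAddOrder T ∧ R = k • P + T := fun R ↦ by
    obtain ⟨a, t, ht, hR⟩ := hgen R
    exact ⟨a, t, by convert ht, by convert hR⟩
  exact k V C f ϖ L P n hC hgood hap hCM hin hf hϖ hL
    (eq_zero_of_prime_smul_eq_zero_padic_of_quadraticTwist_goodSupersingular hp2 W C V hC hgood hap)
    hP' hgen' hdiv hndiv

/-! ## §1 Pair level on the signed type `(p, I₀*)` -/

/-- **`BSD(W, p)` for a rank-one CM curve of signed local type `(p, I₀*)`, `p ≥ 5`, FROM C-cc-1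
(`h2`) at `(W, p)`, (C1_η) on the CM good-inert curves (`hC1`), the named facts `hmod hGZ hGZK hPT
hnf`, the READINGS `hR2` (Kitajima–Otsuki, typed) and `h74x` (exact Kobayashi 7.4 (ii) at `η`,
hypothesis text), and the displayed period-ratio datum `hper`** — x1b's pair consumer p401735 with
its data produced by `pairData_elim`. (C3_η) is NOT an input. CONDITIONAL on typed conjecture items
and readings; nothing booked; O10 stays OPEN. [cite: Kobayashi2003, §4 (p. 8), Thm. 7.4 (p. 13), Thm. 9.3 (p. 26)]
[cite: KitajimaOtsuki2018, Main Thm. 1.3 (arXiv:1607.03612 p. 3)] [cite: Miller2011LMS, §1 and Def. 1.1] -/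
theorem bsdp_of_hasSignedLocalType_IstarZero_of_valuation_of_readings
    (hmod : hasEntireLFunction_rat) (hGZ : GrossZagier1986_thm_I_7_3)
    (hGZK : rank_eq_analyticRank_of_analyticRank_le_one)
    (hPT : poitouTate_selmerStructure_duality_real ℚ) (hnf : exists_isNewformOf)
    (hper : ∀ (V : WeierstrassCurve ℚ) [V.IsElliptic] [V.IsGloballyMinimal]
      {N : ℕ} [NeZero N] (f : CuspForm (Gamma0 N) 2), IsNewformOf V f →
      V.HasGoodReductionAtPrime p → V.frobeniusTrace p = 0 →
      ∃ ϖ : ℚ, ‖(ϖ : ℚ_[p])‖ ≤ 1 ∧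
        (if Even (p / 2) then (ϖ : ℝ) * V.realPeriodRat = plusPeriod f
          else (ϖ : ℝ) * V.imaginaryPeriodRat = minusPeriod f))
    (hC1 : ∀ (V : WeierstrassCurve ℚ) [V.IsElliptic] [V.IsGloballyMinimal], V.HasCM →
      V.HasGoodReductionAtPrime p → CMInert V p → QuadraticBranchPlusMainConjectureAt V p)
    (W : WeierstrassCurve ℚ) [W.IsElliptic] [W.IsGloballyMinimal]
    (h2 : QuadraticBranchPAdicGrossZagierValuationAt W p)
    (hR2 : OddBranchStrictMinusNoFiniteSubmoduleAt W p)
    (h74x : ∀ (V : WeierstrassCurve ℚ) [V.IsElliptic] [V.IsGloballyMinimal] (C : VariableChange ℚ)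
        {N : ℕ} [NeZero N] {f : CuspForm (Gamma0 N) 2},
        p ≠ 2 → C • W.quadraticTwist ((-1) ^ (p / 2) * p) = V →
        V.HasGoodReductionAtPrime p → V.frobeniusTrace p = 0 →
        QuadraticBranchPlusMainConjectureAt V p → IsNewformOf V f →
        ∀ (ϖ : ℚ), (if Even (p / 2) then (ϖ : ℝ) * V.realPeriodRat = plusPeriod f
            else (ϖ : ℝ) * V.imaginaryPeriodRat = minusPeriod f) →
        ∀ (Lη : IwasawaAlgebra p), IsQuadraticBranchMinusLFunction f p ϖ Lη →
        ∀ (κ : ZpExtension ℚ p) (γ : Field.absoluteGaloisGroup ℚ),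
          κ.IsCyclotomic → κ.IsTopGenerator γ → IsCyclotomicVariable p γ →
        ∀ (D : StrictSignedSelmerDualData W κ ℚ_[p] γ (-1)) (L' : IwasawaAlgebra p),
          Lη = PowerSeries.X * L' → D.charIdeal = Ideal.span {L'})
    (hT : HasSignedLocalType W p (.Istar 0)) (hr : W.analyticRank = 1) (hp5 : 5 ≤ p) :
    BSDp W p :=
  pairData_elim hGZK hnf hper W hT hr hp5
    fun V _ _ _ _ _ _ _ _ _ _ hC hgood hap hCM hin hf hϖ hL htors hP hgen hdiv hndiv ↦
      LevelBridge.bsdp_of_plusMC_of_pAdicGrossZagierValuation_of_readings W p hmod hGZ hGZK hPT hR2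
        h74x ((quadraticBranchPAdicGrossZagierValuationAt_iff W p).mp h2) hp5 hC hgood hap
        (hC1 V hCM hgood hin) hf hϖ hL htors hP hgen hdiv hndiv hr

/-- **The LOWER HALF `MissingLowerBoundAt W p` (`ord_p #Ш(W)_an ≤ ord_p #Ш(W)`) for a rank-one CM
curve of signed local type `(p, I₀*)`, `p ≥ 5`, FROM C-cc-1 (`h2`), (C1_η) on the good twins
(`hC1`), the named facts, the displayed datum `hper`, and ONLY the lower reading `h74l`**
(Kobayashi 7.4 (ii) at `η`, inclusion `Char X^{−,str} ⊆ (L')`; NO Kitajima–Otsuki input) — x1b's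
p400144 with its data produced by `pairData_elim`. CONDITIONAL; nothing booked; O10 stays OPEN.
[cite: Kobayashi2003, §4 (p. 8), Thm. 7.4 (p. 13)] [cite: Miller2011LMS, §1 and Def. 1.1] -/
theorem missingLowerBoundAt_of_hasSignedLocalType_IstarZero_of_valuation_of_lowerReading
    (hmod : hasEntireLFunction_rat) (hGZ : GrossZagier1986_thm_I_7_3)
    (hGZK : rank_eq_analyticRank_of_analyticRank_le_one)
    (hPT : poitouTate_selmerStructure_duality_real ℚ) (hnf : exists_isNewformOf)
    (hper : ∀ (V : WeierstrassCurve ℚ) [V.IsElliptic] [V.IsGloballyMinimal]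
      {N : ℕ} [NeZero N] (f : CuspForm (Gamma0 N) 2), IsNewformOf V f →
      V.HasGoodReductionAtPrime p → V.frobeniusTrace p = 0 →
      ∃ ϖ : ℚ, ‖(ϖ : ℚ_[p])‖ ≤ 1 ∧
        (if Even (p / 2) then (ϖ : ℝ) * V.realPeriodRat = plusPeriod f
          else (ϖ : ℝ) * V.imaginaryPeriodRat = minusPeriod f))
    (hC1 : ∀ (V : WeierstrassCurve ℚ) [V.IsElliptic] [V.IsGloballyMinimal], V.HasCM →
      V.HasGoodReductionAtPrime p → CMInert V p → QuadraticBranchPlusMainConjectureAt V p)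
    (W : WeierstrassCurve ℚ) [W.IsElliptic] [W.IsGloballyMinimal]
    (h2 : QuadraticBranchPAdicGrossZagierValuationAt W p)
    (h74l : ∀ (V : WeierstrassCurve ℚ) [V.IsElliptic] [V.IsGloballyMinimal] (C : VariableChange ℚ)
        {N : ℕ} [NeZero N] {f : CuspForm (Gamma0 N) 2},
        p ≠ 2 → C • W.quadraticTwist ((-1) ^ (p / 2) * p) = V →
        V.HasGoodReductionAtPrime p → V.frobeniusTrace p = 0 →
        QuadraticBranchPlusMainConjectureAt V p → IsNewformOf V f →
        ∀ (ϖ : ℚ), (if Even (p / 2) then (ϖ : ℝ) * V.realPeriodRat = plusPeriod f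
            else (ϖ : ℝ) * V.imaginaryPeriodRat = minusPeriod f) →
        ∀ (Lη : IwasawaAlgebra p), IsQuadraticBranchMinusLFunction f p ϖ Lη →
        ∀ (κ : ZpExtension ℚ p) (γ : Field.absoluteGaloisGroup ℚ),
          κ.IsCyclotomic → κ.IsTopGenerator γ → IsCyclotomicVariable p γ →
        ∀ (D : StrictSignedSelmerDualData W κ ℚ_[p] γ (-1)) (L' : IwasawaAlgebra p),
          Lη = PowerSeries.X * L' → D.charIdeal ≤ Ideal.span {L'})
    (hT : HasSignedLocalType W p (.Istar 0)) (hr : W.analyticRank = 1) (hp5 : 5 ≤ p) :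
    MissingLowerBoundAt W p :=
  pairData_elim hGZK hnf hper W hT hr hp5
    fun V _ _ _ _ _ _ _ _ _ _ hC hgood hap hCM hin hf hϖ hL htors hP hgen hdiv hndiv ↦
      LevelBridge.missingLowerBoundAt_of_plusMC_of_pAdicGrossZagierValuation_of_lowerReading W p hmod
        hGZ hGZK hPT h74l ((quadraticBranchPAdicGrossZagierValuationAt_iff W p).mp h2) hp5 hC hgood
        hap (hC1 V hCM hgood hin) hf hϖ hL htors hP hgen hdiv hndiv hr

/-- **`BSD(W, p)` on the signed type `(p, I₀*)`, `p ≥ 5`, with the two readings in their VERBATIM,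
`W`-FREE SHAPES**: `hKO` (Kitajima–Otsuki Main Thm. 1.3 on the `η`-part dual datum of ANY good
`a_p = 0` curve `V`) and `h74X` (Kobayashi Thm. 7.4 (ii) exact, on the same object) — through x1b's
dictionary theorems (`…_of_kitajimaOtsuki`, `exactOddBranchReading_of_kobayashi74OddEtaExact`).
The class form `LowerHalfOnType p I₀*` follows by `lowerHalfOnType_of_forall_bsdp`. CONDITIONAL on
C-cc-1 (`h2`), (C1_η) (`hC1`), named facts, readings, `hper`; nothing booked.
[cite: KitajimaOtsuki2018, Main Thm. 1.3 (= Thm. 4.8) with Def. 2.1 (arXiv:1607.03612 pp. 3, 6)]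
[cite: Kobayashi2003, Thm. 7.4 (p. 13), §4 (p. 8)] [cite: Miller2011LMS, §1 and Def. 1.1] -/
theorem bsdp_of_hasSignedLocalType_IstarZero_of_valuation_of_verbatimReadings
    (hmod : hasEntireLFunction_rat) (hGZ : GrossZagier1986_thm_I_7_3)
    (hGZK : rank_eq_analyticRank_of_analyticRank_le_one)
    (hPT : poitouTate_selmerStructure_duality_real ℚ) (hnf : exists_isNewformOf)
    (hper : ∀ (V : WeierstrassCurve ℚ) [V.IsElliptic] [V.IsGloballyMinimal]
      {N : ℕ} [NeZero N] (f : CuspForm (Gamma0 N) 2), IsNewformOf V f →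
      V.HasGoodReductionAtPrime p → V.frobeniusTrace p = 0 →
      ∃ ϖ : ℚ, ‖(ϖ : ℚ_[p])‖ ≤ 1 ∧
        (if Even (p / 2) then (ϖ : ℝ) * V.realPeriodRat = plusPeriod f
          else (ϖ : ℝ) * V.imaginaryPeriodRat = minusPeriod f))
    (hC1 : ∀ (V : WeierstrassCurve ℚ) [V.IsElliptic] [V.IsGloballyMinimal], V.HasCM →
      V.HasGoodReductionAtPrime p → CMInert V p → QuadraticBranchPlusMainConjectureAt V p)
    (hKO : ∀ (K₀ : Type) [Field K₀] [NumberField K₀] [IsCyclotomicExtension {p} ℚ K₀]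
        [(galRange (K := ℚ) K₀).Normal] (ηq : absoluteGaloisGroup ℚ →* ℤˣ),
        (∀ σ ∈ galRange (K := ℚ) K₀, ηq σ = 1) →
      ∀ (V : WeierstrassCurve ℚ) [V.IsElliptic] [V.IsGloballyMinimal],
        p ≠ 2 → V.HasGoodReductionAtPrime p → V.frobeniusTrace p = 0 →
      ∀ (κ : ZpExtension ℚ p) (γ : absoluteGaloisGroup ℚ),
        κ.IsCyclotomic → κ.IsTopGenerator γ → γ ∈ galRange (K := ℚ) K₀ →
      ∀ (D : EtaSignedSelmerDualData V κ K₀ ℚ_[p] ηq γ (-1)),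
        Module.Finite (IwasawaAlgebra p) D.X → Module.IsTorsion (IwasawaAlgebra p) D.X →
        ∀ M : Submodule (IwasawaAlgebra p) D.X, Finite M → M = ⊥)
    (h74X : ∀ (K₀ : Type) [Field K₀] [NumberField K₀] [IsCyclotomicExtension {p} ℚ K₀]
        [(galRange (K := ℚ) K₀).Normal] (ηq : absoluteGaloisGroup ℚ →* ℤˣ),
        (∀ σ ∈ galRange (K := ℚ) K₀, ηq σ = 1) → ηq ≠ 1 →
      ∀ (V : WeierstrassCurve ℚ) [V.IsElliptic] [V.IsGloballyMinimal] {N : ℕ} [NeZero N]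
        {f : CuspForm (Gamma0 N) 2},
        p ≠ 2 → V.HasGoodReductionAtPrime p → V.frobeniusTrace p = 0 →
        QuadraticBranchPlusMainConjectureAt V p → IsNewformOf V f →
      ∀ (ϖ : ℚ), (if Even (p / 2) then (ϖ : ℝ) * V.realPeriodRat = plusPeriod f
          else (ϖ : ℝ) * V.imaginaryPeriodRat = minusPeriod f) →
      ∀ (Lη : IwasawaAlgebra p), IsQuadraticBranchMinusLFunction f p ϖ Lη →
      ∀ (κ : ZpExtension ℚ p) (γ : absoluteGaloisGroup ℚ),
        κ.IsCyclotomic → κ.IsTopGenerator γ → γ ∈ galRange (K := ℚ) K₀ →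
        IsCyclotomicVariable p γ →
      ∀ (D : EtaSignedSelmerDualData V κ K₀ ℚ_[p] ηq γ (-1)) (L' : IwasawaAlgebra p),
        Lη = PowerSeries.X * L' → D.charIdeal = Ideal.span {L'})
    (W : WeierstrassCurve ℚ) [W.IsElliptic] [W.IsGloballyMinimal]
    (h2 : QuadraticBranchPAdicGrossZagierValuationAt W p)
    (hT : HasSignedLocalType W p (.Istar 0)) (hr : W.analyticRank = 1) (hp5 : 5 ≤ p) :
    BSDp W p :=
  pairData_elim hGZK hnf hper W hT hr hp5
    fun V _ _ _ _ _ _ _ _ _ _ hC hgood hap hCM hin hf hϖ hL htors hP hgen hdiv hndiv ↦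
      LevelBridge.bsdp_of_plusMC_of_pAdicGrossZagierValuation_of_kitajimaOtsuki W p hmod hGZ hGZK hPT
        hKO (LevelBridge.exactOddBranchReading_of_kobayashi74OddEtaExact W p h74X)
        ((quadraticBranchPAdicGrossZagierValuationAt_iff W p).mp h2) hp5 hC hgood hap
        (hC1 V hCM hgood hin) hf hϖ hL htors hP hgen hdiv hndiv hr

/-! ## §2 Class level: the O10-PS node of record `LowerHalfOnType p I₀*` -/

/-- **THE O10-PS NODE OF RECORD (v3, D45): `LowerHalfOnType p I₀*`, `p ≥ 5`** ⟸ C-cc-1 on every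
rank-one CM curve of signed type `(p, I₀*)` (`hIn`) ∧ (C1_η) on the CM good-inert curves (`hC1`) ∧
the named facts `hmod hGZ hGZK hPT hnf` ∧ the LOWER reading of Kobayashi 7.4 (ii) at `η` on the type
(`h74l`, inclusion only; NO Kitajima–Otsuki input) ∧ the ONE displayed analytic datum `hper`
(`p`-integral rational period ratio). Supersedes `lowerHalfOnType_IstarZero_of_valuation_of_exactControl`
((C3_η) and `hdata` are no longer inputs). CONDITIONAL on typed conjecture items and a print reading;
nothing booked; no label moves; O10 stays OPEN at class level.
[cite: Kobayashi2003, §4 (p. 8), Thm. 7.4 (p. 13), Thm. 3.2 (p. 7)] [cite: Tian2023CongruentICM, p. 1993]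
[cite: Miller2011LMS, Def. 1.1] -/
theorem lowerHalfOnType_IstarZero_of_valuation_of_lowerReading
    (hmod : hasEntireLFunction_rat) (hGZ : GrossZagier1986_thm_I_7_3)
    (hGZK : rank_eq_analyticRank_of_analyticRank_le_one)
    (hPT : poitouTate_selmerStructure_duality_real ℚ) (hnf : exists_isNewformOf)
    (hper : ∀ (V : WeierstrassCurve ℚ) [V.IsElliptic] [V.IsGloballyMinimal]
      {N : ℕ} [NeZero N] (f : CuspForm (Gamma0 N) 2), IsNewformOf V f →
      V.HasGoodReductionAtPrime p → V.frobeniusTrace p = 0 →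
      ∃ ϖ : ℚ, ‖(ϖ : ℚ_[p])‖ ≤ 1 ∧
        (if Even (p / 2) then (ϖ : ℝ) * V.realPeriodRat = plusPeriod f
          else (ϖ : ℝ) * V.imaginaryPeriodRat = minusPeriod f))
    (hIn : ∀ (W : WeierstrassCurve ℚ) [W.IsElliptic] [W.IsGloballyMinimal],
      HasSignedLocalType W p (.Istar 0) → W.analyticRank = 1 →
        QuadraticBranchPAdicGrossZagierValuationAt W p)
    (h74l : ∀ (W : WeierstrassCurve ℚ) [W.IsElliptic] [W.IsGloballyMinimal],
      HasSignedLocalType W p (.Istar 0) → W.analyticRank = 1 →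
      ∀ (V : WeierstrassCurve ℚ) [V.IsElliptic] [V.IsGloballyMinimal] (C : VariableChange ℚ)
        {N : ℕ} [NeZero N] {f : CuspForm (Gamma0 N) 2},
        p ≠ 2 → C • W.quadraticTwist ((-1) ^ (p / 2) * p) = V →
        V.HasGoodReductionAtPrime p → V.frobeniusTrace p = 0 →
        QuadraticBranchPlusMainConjectureAt V p → IsNewformOf V f →
        ∀ (ϖ : ℚ), (if Even (p / 2) then (ϖ : ℝ) * V.realPeriodRat = plusPeriod f
            else (ϖ : ℝ) * V.imaginaryPeriodRat = minusPeriod f) →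
        ∀ (Lη : IwasawaAlgebra p), IsQuadraticBranchMinusLFunction f p ϖ Lη →
        ∀ (κ : ZpExtension ℚ p) (γ : Field.absoluteGaloisGroup ℚ),
          κ.IsCyclotomic → κ.IsTopGenerator γ → IsCyclotomicVariable p γ →
        ∀ (D : StrictSignedSelmerDualData W κ ℚ_[p] γ (-1)) (L' : IwasawaAlgebra p),
          Lη = PowerSeries.X * L' → D.charIdeal ≤ Ideal.span {L'})
    (hC1 : ∀ (V : WeierstrassCurve ℚ) [V.IsElliptic] [V.IsGloballyMinimal], V.HasCM →
      V.HasGoodReductionAtPrime p → CMInert V p → QuadraticBranchPlusMainConjectureAt V p)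
    (hp5 : 5 ≤ p) : LowerHalfOnType p (.Istar 0) := fun W _ _ hT hr ↦
  missingLowerBoundAt_of_hasSignedLocalType_IstarZero_of_valuation_of_lowerReading hmod hGZ hGZK hPT
    hnf hper hC1 W (hIn W hT hr) (h74l W hT hr) hT hr hp5

/-- **`LowerHalfOnType p I₀*`, `p ≥ 5`, via `BSD(W, p)` per pair FROM the readings `hR2` (typed, on
the type) and `h74x` (exact, on the type)** — the planner's R230 / D45 (3) shape: C-cc-1 on the type
(`hIn`) ∧ (C1_η) on the good twins ∧ named facts ∧ readings {KO18 (R2), Kob03 7.4 (ii)} ∧ `hper`.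
CONDITIONAL; nothing booked; no label moves; O10 stays OPEN.
[cite: Kobayashi2003, §4 (p. 8), Thm. 7.4 (p. 13)] [cite: KitajimaOtsuki2018, Main Thm. 1.3 (arXiv:1607.03612 p. 3)]
[cite: Miller2011LMS, Def. 1.1] -/
theorem lowerHalfOnType_IstarZero_of_valuation_of_readings
    (hmod : hasEntireLFunction_rat) (hGZ : GrossZagier1986_thm_I_7_3)
    (hGZK : rank_eq_analyticRank_of_analyticRank_le_one)
    (hPT : poitouTate_selmerStructure_duality_real ℚ) (hnf : exists_isNewformOf)
    (hper : ∀ (V : WeierstrassCurve ℚ) [V.IsElliptic] [V.IsGloballyMinimal]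
      {N : ℕ} [NeZero N] (f : CuspForm (Gamma0 N) 2), IsNewformOf V f →
      V.HasGoodReductionAtPrime p → V.frobeniusTrace p = 0 →
      ∃ ϖ : ℚ, ‖(ϖ : ℚ_[p])‖ ≤ 1 ∧
        (if Even (p / 2) then (ϖ : ℝ) * V.realPeriodRat = plusPeriod f
          else (ϖ : ℝ) * V.imaginaryPeriodRat = minusPeriod f))
    (hIn : ∀ (W : WeierstrassCurve ℚ) [W.IsElliptic] [W.IsGloballyMinimal],
      HasSignedLocalType W p (.Istar 0) → W.analyticRank = 1 →
        QuadraticBranchPAdicGrossZagierValuationAt W p)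
    (hR2 : ∀ (W : WeierstrassCurve ℚ) [W.IsElliptic] [W.IsGloballyMinimal],
      HasSignedLocalType W p (.Istar 0) → W.analyticRank = 1 →
        OddBranchStrictMinusNoFiniteSubmoduleAt W p)
    (h74x : ∀ (W : WeierstrassCurve ℚ) [W.IsElliptic] [W.IsGloballyMinimal],
      HasSignedLocalType W p (.Istar 0) → W.analyticRank = 1 →
      ∀ (V : WeierstrassCurve ℚ) [V.IsElliptic] [V.IsGloballyMinimal] (C : VariableChange ℚ)
        {N : ℕ} [NeZero N] {f : CuspForm (Gamma0 N) 2},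
        p ≠ 2 → C • W.quadraticTwist ((-1) ^ (p / 2) * p) = V →
        V.HasGoodReductionAtPrime p → V.frobeniusTrace p = 0 →
        QuadraticBranchPlusMainConjectureAt V p → IsNewformOf V f →
        ∀ (ϖ : ℚ), (if Even (p / 2) then (ϖ : ℝ) * V.realPeriodRat = plusPeriod f
            else (ϖ : ℝ) * V.imaginaryPeriodRat = minusPeriod f) →
        ∀ (Lη : IwasawaAlgebra p), IsQuadraticBranchMinusLFunction f p ϖ Lη →
        ∀ (κ : ZpExtension ℚ p) (γ : Field.absoluteGaloisGroup ℚ),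
          κ.IsCyclotomic → κ.IsTopGenerator γ → IsCyclotomicVariable p γ →
        ∀ (D : StrictSignedSelmerDualData W κ ℚ_[p] γ (-1)) (L' : IwasawaAlgebra p),
          Lη = PowerSeries.X * L' → D.charIdeal = Ideal.span {L'})
    (hC1 : ∀ (V : WeierstrassCurve ℚ) [V.IsElliptic] [V.IsGloballyMinimal], V.HasCM →
      V.HasGoodReductionAtPrime p → CMInert V p → QuadraticBranchPlusMainConjectureAt V p)
    (hp5 : 5 ≤ p) : LowerHalfOnType p (.Istar 0) :=
  lowerHalfOnType_of_forall_bsdp hGZK fun W _ _ hT hr ↦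
    bsdp_of_hasSignedLocalType_IstarZero_of_valuation_of_readings hmod hGZ hGZK hPT hnf hper hC1 W
      (hIn W hT hr) (hR2 W hT hr) (h74x W hT hr) hT hr hp5

end Summit.BirchSwinnertonDyer.Rank1Residual.X12.O10

end
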